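import Literature.MathematicalPhysics.QuantumFieldTheory.Balaban1983to89.Node00.ShearedAveragingFlat
import Literature.MathematicalPhysics.QuantumFieldTheory.Balaban1983to89.Node00.BackgroundActionOfRecord
import Literature.MathematicalPhysics.QuantumFieldTheory.Balaban1983to89.Node00.TorusCoverCubeDomains
import Literature.MathematicalPhysics.QuantumFieldTheory.Balaban1983to89.B15Claim189UnitTestAtRecord

/-!
# NODE 00 — [3] (78)–(88) ∕ [B11] (154)₁ AT THE RECORD: the sheared `j`-fold average of `Node00.ShearedAveragingFlat`, INSTANTIATED at the
# averaging of record `avOfRecord` ((0.4), `exp[mean log]` on `SU(N)`), the contour datum of record `contourOfRecord` ((0.11)) and the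
# `exp[mean log]` block operation of gauge functions — its three hypotheses DISCHARGED, and (154)₁ stated on the `Λ_j` of `Node00.cubeDomains`

Cell `pub-ymgap` (HUMAN RULINGS D-0062 ∕ D-0088 ∕ D-0149), width seat `pub-ymgap-dag-n07-w6` g0 (second wave, director-ym R399 (3a); dag-lead WIDTH-209; lane
owner dag-n07-e g19's WORD-W6 (3) «PAIR ON R4 — the RECORD INSTANCE of INTENT-41»), 2026-08-28.  `--kind definition --supports stmt-QuantumFields-20542`
(K1⁷; count-neutral helper).  Companion of dag-n07-e g19's `Node00.ShearedAveragingFlat` (p607232) = ITEM R4 file 1 of `STUB1-SECTF-MAP.md` § BRIDGE-92-B;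
under the plan's road word (YMPLAN-G83-WORDS-2, road of record R0′) that file is the NAMING SOURCE of the coarse pure gauge `∂_c log S_j(U₁)` ((87)) and
the data identity (154)₁ — both consumed AT THE RECORD through the present instance.

THE PRINT.  [3] = T. Bałaban, *Averaging operations for lattice gauge theories*, Commun. Math. Phys. **98** (1985) 17–51 `[Balaban1985Averaging]`,
pp. 30–31 (READ AS IMAGES `run/shared/lean/pub/pub-balaban/b2b-balaban-ref1/pages/1985-cmp98-averaging/1985-cmp98-averaging-p014-x2.png`, `-p015-x2.png`):
(78) «(R̄₀v)(y) = (R(V₀)v)(y) = v(y) exp[i Σ_{x∈B(y)} L^{−d} (1∕i) log v⁻¹(y)R(V₀(Γ_{y,x}))v(x)]», (81) «(R̄₀uᵏ)(y) = 1, y ∈ Ω^{(k)}», (87) «u(y) =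
(R̄_{0,y}U₁^{(k)})⁻¹», (88) «Ū′ᵏ_b(Ū₀ᵏ)_b⁻¹ = … = (R̄_{0,b₋}U₁^{(k)})⁻¹ Ũ₁ᵏ R̄ᵏ_{0,b} R̄_{0,b₊}U₁^{(k)}, b ⊂ Ω^{(k)}. We may consider this expression as a new averaging
operation of kth order acting on a configuration U₁».  [B11] = T. Bałaban, *The variational problem and background fields in renormalization group method for
lattice gauge theories*, Commun. Math. Phys. **102** (1985) 277–309 `[Balaban1985Variational]`, p. 301 (152) «there exists a unique gauge transformation u satisfying
the restrictions ūʲ = 1 on Λ′_j», p. 302 (154)₁ «Ū₁ʲ(x, x′) = V″(x, x′) for ⟨x, x′⟩ ∈ Λ_j, x, x′ ∈ Λ′_j».  [I] = [Balaban1987RG1] (0.4) p. 253 (the averaging of record),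
(0.11) p. 253 (the averaged contour variables `U(y, x)`).

WHAT THIS FILE DOES (exact algebra ∕ bookkeeping; NOTHING of [3] Sect. 3, [B11] Sect. F or [6] is proved or asserted).  `Node00.ShearedAveragingFlat` types (78)–(88) at
flat background for ABSTRACT data `av` (a point-covariant averaging), `cd` (a contour datum), `𝓔` (a block operation on gauge functions), under three hypotheses:
`h𝓔` (block-locality of `𝓔`, stated at every level), `hctr` («`cd` trivial at the centre» — print's empty contour `Γ_{y,y}`), and the standing range.  Here:
* §1 (generic lattice `P`, gauge group `G`, small-loop average `ℰ : LoopAverage G` — the axiomatised inner operation `exp[mean log]` of `BlockAveraging`): the block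
  operation `loopAvgBlockOp ℰ i y f = ℰ{f(x)}_{x∈B(y)}` of (78) (the base point is factored by n07-e's `gaugeAvgF`), with a range guard that is IDENTICALLY TRUE in the
  standing range (`loopAvgBlockOp_eq`: then it is `ℰ.avg (f ∘ blockSite y)` — print's block family verbatim) and makes block-locality hold at EVERY level
  (★ `loopAvgBlockOp_local` = `h𝓔` discharged); the constant family (`loopAvgBlockOp_congr_one`, `loopAvgBlockOp_one`).
* §2 (generic `GroupAverage 𝓜` with `M(1,…,1) = 1`): the (0.11) contour datum `BlockAveragingTwoLevel.contourData 𝓜` is trivial at the centre — every staircase of offset `0`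
  is the empty word (`stairWord_offset_zero`, `stairHol_offset_zero`, `offsetOf_emb`), so ★ `holTo_contourData_emb` (= `hctr`); and trivial on the unit configuration
  (`holTo_contourData_one`, `axialGauge_contourData_one`).  §2b AT THE RECORD (`F : T4Family`, `SU(N)`): ★ `holTo_contourOfRecord_emb` (`hctr` for `Node00.contourOfRecord`
  = Federbush's mean, `FederbushMean.federbushSU_const`), `holTo_contourOfRecord_one`, `axialGauge_contourOfRecord_one`, `axialGauge_iter_avOfRecord_one`
  (`M^i(1) = 1`, `B15Claim189UnitTestAtRecord.iter_avOfRecord_one`), `expMeanLogSU_E_one'` (`T3DescentFibreTower.expMeanLogSU_E_one` in the letter `SU N`).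
* §3 THE INSTANCE: `gaugeAvgF_loopAvgBlockOp_apply` ((78) verbatim in range), `gaugeAvgIter_loopAvgBlockOp_one` (`R̄ʲ1 = 1`: the (81)∕(1.29) normalisation is inhabited),
  `shearRIter_avOfRecord_one` (`S_j(1) = 1`); ★★★ `shearedAvgIter_avOfRecord_eq_iter_gauge` — n07-e's (88)∕(154)₁ with `av := avOfRecord F N K`, `cd := contourOfRecord F N K`,
  `𝓔 := loopAvgBlockOp expMeanLogSU`, hypotheses `h𝓔`, `hctr` GONE: under the block axial gauges of `M^i(U₁^u)`, `i < j ≤ m + K`, and the normalisation `R̄ʲu = 1` at both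
  ends of `c`, `(S_j(c₋))⁻¹·M^j(U₁)(c)·S_j(c₊) = M^j(U₁^u)(c)`; ★★★ `shearedAvgIter_avOfRecord_eq_data` (… `= V″(c)` under the (150) constraint at `c` — a constraint on `U₁` ALONE
  with PURE data); `shearedAvgIter_avOfRecord_eq_iter_gauge_cd` (any contour system of the record's tori, `hctr` displayed — N09's letters keep `cd` generic);
  `shearedAvg_avOfRecord_eq_avg_gauge` (one step); ★★ `shearedAvgIter_avOfRecord_eq_data_of_lamSite` ∕ `…_cubeDomains` ((154)₁ AS PRINT STATES IT: (1.29) «ūʲ = 1 on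
  Λ′_j» = normalisation on the `Λ_j`-sites of a nested domain family `D` ∕ of `Node00.cubeDomains` (module 39, over which print's `Λ′_j` lies by
  `lamSite_cubeDomains_of_mem_cubeLam`), both ends of `c` in `Λ_j` ⇒ `= V″(c)`); ★ A6 NON-VACUITY `shearedAvgIter_avOfRecord_one`, `shearedAvgIter_avOfRecord_hypotheses_one`
  (at `U₁ = u = 1` every hypothesis holds and both sides are `1`).

HONEST FRAMING (binding).  Count-neutral helper; one small range-guarded `def` (§1) and by-name compositions of landed theorems (n07-e p607232, node00-def
`DatumAvLayer` ∕ `BackgroundActionOfRecord`, pv26 `BlockAveragingTwoLevel`, b2b `BlockAveragingFederbush` ∕ `T3DescentFibreTower`, r-N12 `B15Claim189UnitTestAtRecord`,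
n07-e module 39).  The axial gauges of `M^i(U′)` and the (81)∕(1.29) normalisation of `u` are HYPOTHESES — [B11] Sect. F's set-up ([6] Thm 2's `u`), NOT constructed here;
print's (92), the linearisation (157) and the heart (158)–(168) are NOT here; BRIDGE-92-B stays GAP-STATED until the plan's rows (r0)–(r3) land; tokens ∕ stub 1 ∕ K0⁷ ∕
K1⁷ NOT closed; N07 NOT discharged (typed 28∕28 · discharged 5∕27 unmoved); no summit statement is proved by this seat; one finite `T⁴` programme at fixed `ε`, Bałaban AS
PRINTED with locators — the route closes the conditional finite-𝕋⁴ rung `BalabanLadder.UV` only; NOT continuum ∕ ℝ⁴ ∕ OS ∕ mass gap ∕ Clay.  No `sorry`, no `instance`, no `notation`.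
-/

noncomputable section

namespace Literature.MathematicalPhysics.QuantumFieldTheory.Balaban1983to89.Node00

open T4Continuum BlockAveraging BlockAveragingTwoLevel ExpMeanLog
open GaugeField (gaugeAct)

/-! ## §1  The block operation of (78) with the base point factored: `𝓔_y{f} = ℰ{f(x)}_{x ∈ B(y)}` for a small-loop average `ℰ` -/

section BlockOp

variable {P : Params} {G : Type*} [GaugeGroup G] (ℰ : LoopAverage G)

/-- **The block operation of [3] (78) for an axiomatic small-loop average `ℰ`** (print: `exp[i Σ_{x∈B(y)} L^{−d} (1∕i) log ·]`, the same
inner operation `exp[mean log]` as in the (0.4) averaging of record): the `ℰ`-average of the block family `{f(x)}_{x ∈ B(y)}`, the block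
`B(y)` parametrised by the offsets `r ∈ {0,…,L−1}^d` (`TorusGeometry` `Site.blockSite y r`).  The guard «`blockOf (blockSite y r) = y`» is
IDENTICALLY TRUE in the standing range `i + 1 ≤ m + K` (`Site.blockOf_blockSite`; `loopAvgBlockOp_eq`) and is present only so that
block-locality (`loopAvgBlockOp_local`) holds at the junk levels too, where `Node00.ShearedAveragingFlat`'s hypothesis `h𝓔` is stated
unguarded. [cite: Balaban1985Averaging, (78) p.30] -/
def loopAvgBlockOp (i : ℕ) (y : Site P (i + 1)) (f : Site P i → G) : G :=
  ℰ.avg fun r : Fin P.d → Fin P.L => if blockOf (Site.blockSite y r) = y then f (Site.blockSite y r) else 1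

/-- ★ **Block-locality of the (78) block operation, at EVERY level** (= hypothesis `h𝓔` of `Node00.ShearedAveragingFlat`): the value at `y`
depends only on `f` on `B(y)`. [cite: Balaban1985Averaging, (78) p.30] -/
theorem loopAvgBlockOp_local (i : ℕ) (y : Site P (i + 1)) (f f' : Site P i → G) (h : ∀ x, blockOf x = y → f x = f' x) :
    loopAvgBlockOp ℰ i y f = loopAvgBlockOp ℰ i y f' := by
  unfold loopAvgBlockOp
  congr 1
  funext r
  by_cases hr : blockOf (Site.blockSite y r) = y
  · rw [if_pos hr, if_pos hr, h _ hr]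
  · rw [if_neg hr, if_neg hr]

/-- In the standing range the guard is idle: `𝓔_y{f} = ℰ{f(blockSite y r)}_{r ∈ {0,…,L−1}^d}` — print's block family `{·(x)}_{x∈B(y)}` verbatim.
[cite: Balaban1985Averaging, (78) p.30] -/
theorem loopAvgBlockOp_eq {i : ℕ} (hi : i + 1 ≤ P.m + P.K) (y : Site P (i + 1)) (f : Site P i → G) :
    loopAvgBlockOp ℰ i y f = ℰ.avg fun r : Fin P.d → Fin P.L => f (Site.blockSite y r) := by
  unfold loopAvgBlockOp
  congr 1
  funext r
  rw [if_pos (Site.blockOf_blockSite hi y r)]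

/-- For a small-loop average with `ℰ(1,…,1) = 1` (the printed `exp[mean log]`: `T3DescentFibreTower.expMeanLogSU_E_one`), a family that is
`≡ 1` on the block averages to `1`. [cite: Balaban1985Averaging, (78) p.30] -/
theorem loopAvgBlockOp_congr_one (hE : ∀ n : ℕ, ℰ.E (fun _ : Fin (n + 1) => (1 : G)) = 1) (i : ℕ) (y : Site P (i + 1))
    (f : Site P i → G) (h : ∀ x, blockOf x = y → f x = 1) : loopAvgBlockOp ℰ i y f = 1 := by
  unfold loopAvgBlockOp
  have hfam : (fun r : Fin P.d → Fin P.L => if blockOf (Site.blockSite y r) = y then f (Site.blockSite y r) else 1) = fun _ => 1 := by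
    funext r
    by_cases hr : blockOf (Site.blockSite y r) = y
    · rw [if_pos hr, h _ hr]
    · rw [if_neg hr]
  rw [hfam]
  exact hE _

/-- In particular the constant family `1` averages to `1` at every level. [cite: Balaban1985Averaging, (78) p.30] -/
theorem loopAvgBlockOp_one (hE : ∀ n : ℕ, ℰ.E (fun _ : Fin (n + 1) => (1 : G)) = 1) (i : ℕ) (y : Site P (i + 1)) :
    loopAvgBlockOp ℰ i y (fun _ => 1) = 1 :=
  loopAvgBlockOp_congr_one ℰ hE i y _ fun _ _ => rfl

end BlockOp

/-! ## §2  The (0.11) contour datum is trivial at the centre (print's empty contour `Γ_{y,y}`) and at the unit configuration -/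

section Contour

variable {P : Params} {j : ℕ} {G : Type*} [GaugeGroup G]

/-- The staircase word of the zero offset is empty: `Γ^σ_{y,y} = ∅` for every ordering `σ` of the axes (the same three-line lattice fact is the Summits-side
`Summit.QuantumFields.BalabanUV.T4Continuum.Spine.NE7.QLaBlockAvgLinear.stairWord_zero`, which a Literature file cannot import — restated here with this pointer). [cite: Balaban1987RG1, (0.3) p.252] -/
theorem stairWord_offset_zero {d : ℕ} (σ : Equiv.Perm (Fin d)) : stairWord σ (0 : Fin d → ℤ) = [] := by
  unfold stairWord
  generalize (List.finRange d).map σ = as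
  induction as with
  | nil => rfl
  | cons a as ih => simpa [stairRuns, axisRun] using ih

/-- Hence every staircase holonomy from the centre to the centre is `1`. [cite: Balaban1987RG1, (0.11) p.253] -/
theorem stairHol_offset_zero (U : GaugeField P j G) (y : Site P (j + 1)) : stairHol U y 0 = fun _ => 1 := by
  funext σ
  unfold stairHol
  rw [stairWord_offset_zero]
  exact holAt_nil U

/-- The centred offset of the centre is `0` (the offset `n = x − y` of [I] (0.3) p.252 at `x = y`). [cite: Balaban1987RG1, (0.3) p.252] -/
theorem offsetOf_emb (y : Site P (j + 1)) : offsetOf y (emb y) = 0 := by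
  funext ν
  simp [offsetOf]

/-- Staircase holonomies of the unit configuration are `1`. [cite: Balaban1987RG1, (0.11) p.253] -/
theorem stairHol_one (y : Site P (j + 1)) (n : Fin P.d → ℤ) : stairHol (1 : GaugeField P j G) y n = fun _ => 1 := by
  funext σ
  exact T3DescentFibreTower.holAt_one _

variable (𝓜 : GroupAverage G)

/-- The constant family `1` is admissible for every axiomatic group average. [cite: Balaban1987RG1, (0.5) p.253] -/
theorem adm_const_one {ι : Type*} : 𝓜.Adm (fun _ : ι => (1 : G)) := fun _ _ => by
  rw [mul_inv_cancel, GaugeGroup.dist1_one]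
  exact 𝓜.δ_pos

/-- ★ **`hctr` for the (0.11) contour datum**: for a group average with `M(1,…,1) = 1`, the averaged contour variable from the centre to ITSELF is
`1` — print's `Γ_{y,y}` is the empty contour (every staircase of offset `0` is empty, and the average of the constant family `1` is `1`).
[cite: Balaban1987RG1, (0.11) p.253] -/
theorem holTo_contourData_emb (h𝓜 : ∀ n : ℕ, 𝓜.M (fun _ : Fin (n + 1) => (1 : G)) = 1) (U : GaugeField P j G) (y : Site P (j + 1)) :
    (contourData 𝓜 : ContourData P j G).holTo U y (emb y) = 1 := by
  show BlockAveragingTwoLevel.holTo 𝓜 U y (emb y) = 1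
  have hadm : 𝓜.Adm (stairHol U y (offsetOf y (emb y))) := by
    rw [offsetOf_emb, stairHol_offset_zero]
    exact adm_const_one 𝓜
  rw [holTo_of_adm 𝓜 U y _ hadm, offsetOf_emb]
  unfold cVar
  rw [stairHol_offset_zero]
  exact h𝓜 _

/-- The (0.11) contour variables of the UNIT configuration are `1` (for `M(1,…,1) = 1`). [cite: Balaban1987RG1, (0.11) p.253] -/
theorem holTo_contourData_one (h𝓜 : ∀ n : ℕ, 𝓜.M (fun _ : Fin (n + 1) => (1 : G)) = 1) (y : Site P (j + 1)) (x : Site P j) :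
    (contourData 𝓜 : ContourData P j G).holTo 1 y x = 1 := by
  show BlockAveragingTwoLevel.holTo 𝓜 1 y x = 1
  have hadm : 𝓜.Adm (stairHol (1 : GaugeField P j G) y (offsetOf y x)) := by
    rw [stairHol_one]
    exact adm_const_one 𝓜
  rw [holTo_of_adm 𝓜 1 y x hadm]
  unfold cVar
  rw [stairHol_one]
  exact h𝓜 _

/-- Hence the unit configuration is in the block axial gauge of the (0.11) contour datum. [cite: Balaban1987RG1, (2.3) p.265] -/
theorem axialGauge_contourData_one (h𝓜 : ∀ n : ℕ, 𝓜.M (fun _ : Fin (n + 1) => (1 : G)) = 1) :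
    AxialGauge (contourData 𝓜 : ContourData P j G) 1 :=
  fun y x _ _ => holTo_contourData_one 𝓜 h𝓜 y x

end Contour

/-! ## §2b  At the record: `contourOfRecord` (Federbush's mean) and `avOfRecord` (`exp[mean log]`) -/

section Record

variable (F : T4Family) (N : ℕ) [NeZero N]

/-- Federbush's mean of a constant family is the constant (`FederbushMean.federbushSU_const`). [cite: Balaban1987RG1, (0.10) p.253] -/
theorem federbushSU_M_one (n : ℕ) : (FederbushMean.federbushSU (n := Fin N)).M (fun _ : Fin (n + 1) => (1 : SU N)) = 1 :=
  FederbushMean.federbushSU_const 1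

/-- ★ **`hctr` AT THE RECORD**: the contour datum OF RECORD ([I] (0.11) with Federbush's inner mean, `Node00.contourOfRecord`) is trivial at the centre —
`U(y, y) = 1` for every torus `K`, level `i`, configuration `U` and coarse site `y`. [cite: Balaban1987RG1, (0.11) p.253] -/
theorem holTo_contourOfRecord_emb (K i : ℕ) (U : GaugeField (F.P K) i (SU N)) (y : Site (F.P K) (i + 1)) :
    (contourOfRecord F N K i).holTo U y (emb y) = 1 :=
  holTo_contourData_emb _ (federbushSU_M_one N) U y

/-- The contour variables of record of the unit configuration are `1`. [cite: Balaban1987RG1, (0.11) p.253] -/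
theorem holTo_contourOfRecord_one (K i : ℕ) (y : Site (F.P K) (i + 1)) (x : Site (F.P K) i) :
    (contourOfRecord F N K i).holTo 1 y x = 1 :=
  holTo_contourData_one _ (federbushSU_M_one N) y x

/-- The unit configuration is in the block axial gauge of the contour datum of record, at every level. [cite: Balaban1987RG1, (2.3) p.265] -/
theorem axialGauge_contourOfRecord_one (K i : ℕ) : AxialGauge (contourOfRecord F N K i) (1 : GaugeField (F.P K) i (SU N)) :=
  axialGauge_contourData_one _ (federbushSU_M_one N)

/-- `M^i(1^1) = 1` at the record, in the block axial gauge (the `hax` binder of the instance is inhabited at `U₁ = u = 1`;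
`B15Claim189UnitTestAtRecord.iter_avOfRecord_one`). [cite: Balaban1987RG1, (0.4) p.253] -/
theorem axialGauge_iter_avOfRecord_one (K i : ℕ) :
    AxialGauge (contourOfRecord F N K i)
      (Averaging.iter (avOfRecord F N K) i (gaugeAct (fun _ => (1 : SU N)) (1 : GaugeField (F.P K) 0 (SU N)))) := by
  rw [B12RTGaugeInvariance254.gaugeAct_one', B15Claim189UnitTestAtRecord.iter_avOfRecord_one F N K i]
  exact axialGauge_contourOfRecord_one F N K i

/-- The printed `exp[mean log]` on `SU(N)` maps constant families `1` to `1` (`T3DescentFibreTower.expMeanLogSU_E_one`), in the letter `SU N`.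
[cite: Balaban1987RG1, (0.4) p.253] -/
theorem expMeanLogSU_E_one' (n : ℕ) : (expMeanLogSU (n := Fin N)).E (fun _ : Fin (n + 1) => (1 : SU N)) = 1 :=
  T3DescentFibreTower.expMeanLogSU_E_one n

end Record

/-! ## §3  THE RECORD INSTANCE of `Node00.ShearedAveragingFlat`: `av := avOfRecord F N K`, `cd := contourOfRecord F N K`, `𝓔 := loopAvgBlockOp expMeanLogSU` -/

section Instance

variable {P : Params} {G : Type*} [GaugeGroup G] (ℰ : LoopAverage G)

/-- **(78) VERBATIM in the standing range**: with the block operation `loopAvgBlockOp ℰ`, n07-e's base-point-factored average `gaugeAvgF` reads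
`(R̄v)(y) = v(y)·ℰ{v(y)⁻¹v(x)}_{x∈B(y)}` (flat background, `y` = the centre `emb y`). [cite: Balaban1985Averaging, (78) p.30] -/
theorem gaugeAvgF_loopAvgBlockOp_apply {i : ℕ} (hi : i + 1 ≤ P.m + P.K) (v : GaugeTransf P i G) (y : Site P (i + 1)) :
    gaugeAvgF (loopAvgBlockOp ℰ i) v y = v (emb y) * ℰ.avg (fun r : Fin P.d → Fin P.L => (v (emb y))⁻¹ * v (Site.blockSite y r)) := by
  unfold gaugeAvgF
  rw [loopAvgBlockOp_eq ℰ hi]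

/-- **The (81)∕(1.29) normalisation is inhabited**: `R̄ʲ1 = 1` at every level for `ℰ(1,…,1) = 1`. [cite: Balaban1985Averaging, (81) p.30] -/
theorem gaugeAvgIter_loopAvgBlockOp_one (hE : ∀ n : ℕ, ℰ.E (fun _ : Fin (n + 1) => (1 : G)) = 1) :
    ∀ j : ℕ, gaugeAvgIter (P := P) (loopAvgBlockOp ℰ) (fun _ => 1) j = fun _ => 1
  | 0 => rfl
  | j + 1 => by
    rw [gaugeAvgIter_succ, gaugeAvgIter_loopAvgBlockOp_one hE j]
    funext y
    unfold gaugeAvgF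
    rw [one_mul]
    simp only [inv_one, mul_one]
    exact loopAvgBlockOp_one ℰ hE j y

variable (F : T4Family) (N : ℕ) [NeZero N]

/-- **`S_j(1) = 1`**: the intrinsic factor of record of the unit configuration is `1` at every level. [cite: Balaban1985Averaging, (85) p.31] -/
theorem shearRIter_avOfRecord_one (K : ℕ) :
    ∀ j : ℕ, shearRIter (avOfRecord F N K) (contourOfRecord F N K) (loopAvgBlockOp expMeanLogSU) (1 : GaugeField (F.P K) 0 (SU N)) j = fun _ => 1
  | 0 => rfl
  | j + 1 => by
    funext y
    show shearRIter (avOfRecord F N K) (contourOfRecord F N K) (loopAvgBlockOp expMeanLogSU) 1 j (emb y) *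
        loopAvgBlockOp expMeanLogSU j y (fun x => (shearRIter (avOfRecord F N K) (contourOfRecord F N K) (loopAvgBlockOp expMeanLogSU) 1 j (emb y))⁻¹ *
          (contourOfRecord F N K j).holTo (Averaging.iter (avOfRecord F N K) j 1) y x *
          shearRIter (avOfRecord F N K) (contourOfRecord F N K) (loopAvgBlockOp expMeanLogSU) 1 j x) = 1
    rw [shearRIter_avOfRecord_one K j, B15Claim189UnitTestAtRecord.iter_avOfRecord_one F N K j]
    simp only [inv_one, one_mul, mul_one, holTo_contourOfRecord_one]
    exact loopAvgBlockOp_one _ (expMeanLogSU_E_one' N) j y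

/-- ★★★ **[3] (88) ∕ [B11] (154)₁ AT THE RECORD** — the SHEARED `j`-FOLD AVERAGE OF RECORD of `U₁` IS the `j`-fold average of record of the axial-gauged `U′ = U₁^u`:
for the averaging of record `avOfRecord` ((0.4) with `exp[mean log]` on `SU(N)`), the contour datum of record `contourOfRecord` ((0.11)) and the `exp[mean log]` block
operation, under the block axial gauges of `M^i(U′)`, `i < j ≤ m + K`, and the (81)∕(1.29) normalisation `R̄ʲu = 1` at both ends of the bond `c` of `T^{(j)}`:
`(S_j(c₋))⁻¹·M^j(U₁)(c)·S_j(c₊) = M^j(U′)(c)` — n07-e's `shearedAvgIter_eq_iter_gauge` with `h𝓔`, `hctr` DISCHARGED (`loopAvgBlockOp_local`, `holTo_contourOfRecord_emb`).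
[cite: Balaban1985Averaging, (88) p.31; Balaban1985Variational, (154) p.302] -/
theorem shearedAvgIter_avOfRecord_eq_iter_gauge (K : ℕ) {u : GaugeTransf (F.P K) 0 (SU N)} {U₁ : GaugeField (F.P K) 0 (SU N)} {j : ℕ}
    (hj : j ≤ (F.P K).m + (F.P K).K)
    (hax : ∀ i < j, AxialGauge (contourOfRecord F N K i) (Averaging.iter (avOfRecord F N K) i (gaugeAct u U₁)))
    {c : PBond (F.P K) j} (hsrc : gaugeAvgIter (loopAvgBlockOp expMeanLogSU) u j c.src = 1)
    (htgt : gaugeAvgIter (loopAvgBlockOp expMeanLogSU) u j c.tgt = 1) :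
    shearedAvgIter (avOfRecord F N K) (contourOfRecord F N K) (loopAvgBlockOp expMeanLogSU) U₁ j c =
      Averaging.iter (avOfRecord F N K) j (gaugeAct u U₁) c :=
  shearedAvgIter_eq_iter_gauge _ _ _ (loopAvgBlockOp_local expMeanLogSU) (holTo_contourOfRecord_emb F N K) hj hax hsrc htgt

/-- ★★★ **(154)₁ AT THE RECORD, with the constraint**: if moreover `M^j(U′)(c) = V″(c)` (the (150) constraint «`U′ ∈ 𝔅_k(ℭ_k, V″)`» at the bond `c`), the sheared
`j`-fold average of record of `U₁` equals the PURE DATA `V″(c)` — a constraint on `U₁` ALONE. [cite: Balaban1985Variational, (154) p.302, (150) p.301] -/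
theorem shearedAvgIter_avOfRecord_eq_data (K : ℕ) {u : GaugeTransf (F.P K) 0 (SU N)} {U₁ : GaugeField (F.P K) 0 (SU N)} {j : ℕ}
    (hj : j ≤ (F.P K).m + (F.P K).K)
    (hax : ∀ i < j, AxialGauge (contourOfRecord F N K i) (Averaging.iter (avOfRecord F N K) i (gaugeAct u U₁)))
    {V : GaugeField (F.P K) j (SU N)} {c : PBond (F.P K) j} (hV : Averaging.iter (avOfRecord F N K) j (gaugeAct u U₁) c = V c)
    (hsrc : gaugeAvgIter (loopAvgBlockOp expMeanLogSU) u j c.src = 1) (htgt : gaugeAvgIter (loopAvgBlockOp expMeanLogSU) u j c.tgt = 1) :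
    shearedAvgIter (avOfRecord F N K) (contourOfRecord F N K) (loopAvgBlockOp expMeanLogSU) U₁ j c = V c := by
  rw [shearedAvgIter_avOfRecord_eq_iter_gauge F N K hj hax hsrc htgt, hV]

/-- The same for an ARBITRARY contour system `cd` of the record's tori (N09's letters keep `cd` generic), with print's empty-contour clause `hctr` displayed.
[cite: Balaban1985Averaging, (88) p.31; Balaban1985Variational, (154) p.302] -/
theorem shearedAvgIter_avOfRecord_eq_iter_gauge_cd (K : ℕ) (cd : ∀ i, ContourData (F.P K) i (SU N))
    (hctr : ∀ (i : ℕ) (U : GaugeField (F.P K) i (SU N)) (y : Site (F.P K) (i + 1)), (cd i).holTo U y (emb y) = 1)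
    {u : GaugeTransf (F.P K) 0 (SU N)} {U₁ : GaugeField (F.P K) 0 (SU N)} {j : ℕ} (hj : j ≤ (F.P K).m + (F.P K).K)
    (hax : ∀ i < j, AxialGauge (cd i) (Averaging.iter (avOfRecord F N K) i (gaugeAct u U₁)))
    {c : PBond (F.P K) j} (hsrc : gaugeAvgIter (loopAvgBlockOp expMeanLogSU) u j c.src = 1)
    (htgt : gaugeAvgIter (loopAvgBlockOp expMeanLogSU) u j c.tgt = 1) :
    shearedAvgIter (avOfRecord F N K) cd (loopAvgBlockOp expMeanLogSU) U₁ j c = Averaging.iter (avOfRecord F N K) j (gaugeAct u U₁) c :=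
  shearedAvgIter_eq_iter_gauge _ _ _ (loopAvgBlockOp_local expMeanLogSU) hctr hj hax hsrc htgt

/-- The ONE-STEP record instance (n07-e §1 at `T^{(j)} → T^{(j+1)}`): `(R̄_{0,c₋}U₁)⁻¹·Ū₁(c)·R̄_{0,c₊}U₁ = Ū′(c)` for the averaging and contour datum of record at level `j`.
[cite: Balaban1985Averaging, (88) p.31] -/
theorem shearedAvg_avOfRecord_eq_avg_gauge (K : ℕ) {j : ℕ} (hj : j + 1 ≤ (F.P K).m + (F.P K).K) {u : GaugeTransf (F.P K) j (SU N)}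
    {U₁ : GaugeField (F.P K) j (SU N)} (hax : AxialGauge (contourOfRecord F N K j) (gaugeAct u U₁)) {c : PBond (F.P K) (j + 1)}
    (hsrc : gaugeAvgF (loopAvgBlockOp expMeanLogSU j) u c.src = 1) (htgt : gaugeAvgF (loopAvgBlockOp expMeanLogSU j) u c.tgt = 1) :
    shearedAvg (avOfRecord F N K j) (contourOfRecord F N K j) (loopAvgBlockOp expMeanLogSU j) U₁ c = (avOfRecord F N K j).avg (gaugeAct u U₁) c :=
  shearedAvg_eq_avg_gauge _ _ _ hj (loopAvgBlockOp_local expMeanLogSU j) (holTo_contourOfRecord_emb F N K j) hax hsrc htgt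

/-- ★ **A6 NON-VACUITY at the unit configuration**: at `U₁ = 1`, `u = 1` every hypothesis of `shearedAvgIter_avOfRecord_eq_iter_gauge` is inhabited (the axial
gauges by `axialGauge_iter_avOfRecord_one`, the normalisation by `gaugeAvgIter_loopAvgBlockOp_one`) and both sides are `1`. [cite: Balaban1985Variational, (154) p.302] -/
theorem shearedAvgIter_avOfRecord_one (K j : ℕ) :
    shearedAvgIter (avOfRecord F N K) (contourOfRecord F N K) (loopAvgBlockOp expMeanLogSU) (1 : GaugeField (F.P K) 0 (SU N)) j = 1 := by
  funext c
  show (shearRIter (avOfRecord F N K) (contourOfRecord F N K) (loopAvgBlockOp expMeanLogSU) 1 j c.src)⁻¹ *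
      Averaging.iter (avOfRecord F N K) j 1 c * shearRIter (avOfRecord F N K) (contourOfRecord F N K) (loopAvgBlockOp expMeanLogSU) 1 j c.tgt = 1
  rw [shearRIter_avOfRecord_one F N K j, B15Claim189UnitTestAtRecord.iter_avOfRecord_one F N K j]
  simp only [inv_one, one_mul, mul_one]
  rfl

/-- The hypotheses of the ★★★ theorem at `U₁ = u = 1`, as one sentence (A6): axial gauges at every level, normalisation at every site of every level, and the
conclusion's two sides agree. [cite: Balaban1985Variational, (154) p.302] -/
theorem shearedAvgIter_avOfRecord_hypotheses_one (K : ℕ) {j : ℕ} (hj : j ≤ (F.P K).m + (F.P K).K) (c : PBond (F.P K) j) :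
    (∀ i < j, AxialGauge (contourOfRecord F N K i)
        (Averaging.iter (avOfRecord F N K) i (gaugeAct (fun _ => (1 : SU N)) (1 : GaugeField (F.P K) 0 (SU N))))) ∧
      gaugeAvgIter (P := F.P K) (loopAvgBlockOp expMeanLogSU) (fun _ => (1 : SU N)) j c.src = 1 ∧
      gaugeAvgIter (P := F.P K) (loopAvgBlockOp expMeanLogSU) (fun _ => (1 : SU N)) j c.tgt = 1 ∧
      shearedAvgIter (avOfRecord F N K) (contourOfRecord F N K) (loopAvgBlockOp expMeanLogSU) (1 : GaugeField (F.P K) 0 (SU N)) j c =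
        Averaging.iter (avOfRecord F N K) j (gaugeAct (fun _ => (1 : SU N)) (1 : GaugeField (F.P K) 0 (SU N))) c := by
  have h1 := gaugeAvgIter_loopAvgBlockOp_one (P := F.P K) expMeanLogSU (expMeanLogSU_E_one' N) j
  refine ⟨fun i _ => axialGauge_iter_avOfRecord_one F N K i, by rw [h1], by rw [h1], ?_⟩
  exact shearedAvgIter_avOfRecord_eq_iter_gauge F N K hj (fun i _ => axialGauge_iter_avOfRecord_one F N K i) (by rw [h1]) (by rw [h1])

/-- ★★ **(154)₁ AS PRINT STATES IT, for a nested domain family** ([B6] (2.1)∕(2.3) `B6SectADomainsV1.Domains`, e.g. the tower of a cube datum, below): if `u` is (1.29)-normalised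
«`ūʲ = 1` on `Λ_j`» — `R̄ʲu(y) = 1` at every `Λ_j`-SITE of level `j ≤ k` — and `M^i(U′)`, `i < j`, are block-axial, then at every bond `c` of `T^{(j)}` with BOTH ends in `Λ_j`
carrying the (150) constraint `M^j(U′)(c) = V″(c)`, the sheared `j`-fold average of record of `U₁` IS the datum `V″(c)`. [cite: Balaban1985Variational, (152) p.301, (154) p.302] -/
theorem shearedAvgIter_avOfRecord_eq_data_of_lamSite (K : ℕ) (D : B6SectADomainsV1.Domains (F.P K)) {u : GaugeTransf (F.P K) 0 (SU N)}
    {U₁ : GaugeField (F.P K) 0 (SU N)} {j : ℕ} (hjk : j ≤ D.k)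
    (hax : ∀ i < j, AxialGauge (contourOfRecord F N K i) (Averaging.iter (avOfRecord F N K) i (gaugeAct u U₁)))
    (h129 : ∀ y : Site (F.P K) j, D.LamSite j y → gaugeAvgIter (loopAvgBlockOp expMeanLogSU) u j y = 1)
    {V : GaugeField (F.P K) j (SU N)} {c : PBond (F.P K) j} (hs : D.LamSite j c.src) (ht : D.LamSite j c.tgt)
    (hV : Averaging.iter (avOfRecord F N K) j (gaugeAct u U₁) c = V c) :
    shearedAvgIter (avOfRecord F N K) (contourOfRecord F N K) (loopAvgBlockOp expMeanLogSU) U₁ j c = V c :=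
  shearedAvgIter_avOfRecord_eq_data F N K (hjk.trans D.hk) hax hV (h129 _ hs) (h129 _ ht)

/-- ★★ **(154)₁ ON THE `Λ_j` OF THE TORUS TOWER OF A CUBE DATUM** (`Node00.cubeDomains`, n07-e module 39 — the family over which print's `Λ′_j = □_j^{(j)} ∖ □_{j+1}^{(j)}` lies,
`lamSite_cubeDomains_of_mem_cubeLam`): normalisation on the `Λ_j`-sites + block axial gauges below `j` + the constraint at a `Λ_j`-bond ⇒ the sheared average of record of `U₁`
equals `V″` there. [cite: Balaban1985Variational, (154) p.302; Balaban1985RegularSpaces, (1.131) p.99] -/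
theorem shearedAvgIter_avOfRecord_eq_data_cubeDomains (K : ℕ) {a : Fin (F.P K).d → ℤ} {M ρ k : ℕ} (hk : k ≤ (F.P K).m + (F.P K).K)
    {u : GaugeTransf (F.P K) 0 (SU N)} {U₁ : GaugeField (F.P K) 0 (SU N)} {j : ℕ} (hjk : j ≤ k)
    (hax : ∀ i < j, AxialGauge (contourOfRecord F N K i) (Averaging.iter (avOfRecord F N K) i (gaugeAct u U₁)))
    (h129 : ∀ y : Site (F.P K) j, (cubeDomains (F.P K) a M ρ k hk).LamSite j y → gaugeAvgIter (loopAvgBlockOp expMeanLogSU) u j y = 1)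
    {V : GaugeField (F.P K) j (SU N)} {c : PBond (F.P K) j}
    (hs : (cubeDomains (F.P K) a M ρ k hk).LamSite j c.src) (ht : (cubeDomains (F.P K) a M ρ k hk).LamSite j c.tgt)
    (hV : Averaging.iter (avOfRecord F N K) j (gaugeAct u U₁) c = V c) :
    shearedAvgIter (avOfRecord F N K) (contourOfRecord F N K) (loopAvgBlockOp expMeanLogSU) U₁ j c = V c :=
  shearedAvgIter_avOfRecord_eq_data_of_lamSite F N K (cubeDomains (F.P K) a M ρ k hk) hjk hax h129 hs ht hV

end Instance

end Literature.MathematicalPhysics.QuantumFieldTheory.Balaban1983to89.Node00
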